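import Summits.Ventures.HodgeRepro2.T5SU11LegendreCentralBinomial

/-!
# Bounds for the Laplace–Heine asymptotic: `1/(4k) ≤ a_k² ≤ 1/(2k + 1)`, the ratio bounds `a_{n−j}/a_n ≤ 2√n`,
`≤ 2` for `j ≤ n/2`, `≤ (1 + 1/(2(n−m)+1))^m` for `j ≤ m`, and two limits

Elementary two-sided bounds for `a_k = C(2k,k)/4^k` (`T5SU11LegendreHeine.binomHalf`): **`1/(4k) ≤ a_k² ≤ 1/(2k + 1)`**
(`le_binomHalf_sq`, `binomHalf_sq_le`, by induction with `(k+1) a_{k+1} = (k+½) a_k`), hence `1/a_n ≤ 2√n`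
(`inv_binomHalf_le`) and the ratio bounds used block by block in `T5SU11LegendreLaplaceHeine`:
**`a_{n−j}/a_n ≤ 2√n`** (`binomHalf_div_le_sqrt`), **`a_{n−j}/a_n ≤ 2` for `j ≤ n/2`** (`binomHalf_div_le_two`),
**`a_{n−j}/a_n ≤ (1 + 1/(2(n−m)+1))^m` for `j ≤ m ≤ n`** (`binomHalf_div_le_pow`, from
`T5SU11LegendreCentralBinomial.binomHalf_div_le`); and the two limits `(1 + 1/(2(n−m)+1))^m → 1` (`m` fixed,
`tendsto_one_add_pow`) and `n z^{⌊n/2⌋} → 0` for `0 < z < 1` (`tendsto_mul_pow_div_two`). Nothing is claimed about (N).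

Blind lane: Mathlib + the HodgeRepro2 prefix only; no sorry; axioms ⊆ {propext, Classical.choice,
Quot.sound}.
-/

namespace Summit.Ventures.HodgeRepro2.T5SU11LegendreHeineBounds

open Filter Topology Finset
open T5SU11LegendreHeine T5SU11LegendreCentralBinomial

/-! ### Elementary two-sided bounds `1/(4k) ≤ a_k² ≤ 1/(2k + 1)` -/

/-- `a_k² ≤ 1/(2k + 1)`. -/
theorem binomHalf_sq_le (k : ℕ) : binomHalf k ^ 2 ≤ 1 / (2 * (k : ℝ) + 1) := by
  induction k with
  | zero => simp
  | succ k ih =>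
    have h := binomHalf_succ k
    have hk : (0 : ℝ) ≤ k := Nat.cast_nonneg k
    have hp := binomHalf_pos k
    have e : binomHalf (k + 1) = ((k : ℝ) + 1 / 2) / ((k : ℝ) + 1) * binomHalf k := by
      rw [div_mul_eq_mul_div, eq_div_iff (by positivity)]
      linarith [h]
    rw [e, mul_pow]
    push_cast
    calc (((k : ℝ) + 1 / 2) / ((k : ℝ) + 1)) ^ 2 * binomHalf k ^ 2
        ≤ (((k : ℝ) + 1 / 2) / ((k : ℝ) + 1)) ^ 2 * (1 / (2 * (k : ℝ) + 1)) :=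
          mul_le_mul_of_nonneg_left ih (by positivity)
      _ ≤ 1 / (2 * ((k : ℝ) + 1) + 1) := by
          rw [div_pow, div_mul_div_comm, mul_one, div_le_div_iff₀ (by positivity) (by positivity)]
          nlinarith

/-- `1/(4k) ≤ a_k²` for `k ≥ 1`. -/
theorem le_binomHalf_sq {k : ℕ} (hk : 1 ≤ k) : 1 / (4 * (k : ℝ)) ≤ binomHalf k ^ 2 := by
  induction k with
  | zero => omega
  | succ k ih =>
    rcases Nat.eq_zero_or_pos k with rfl | hk'
    · rw [binomHalf_one]; norm_num
    · have h := binomHalf_succ k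
      have hkr : (1 : ℝ) ≤ k := by exact_mod_cast hk'
      have hp := binomHalf_pos k
      have e : binomHalf (k + 1) = ((k : ℝ) + 1 / 2) / ((k : ℝ) + 1) * binomHalf k := by
        rw [div_mul_eq_mul_div, eq_div_iff (by positivity)]
        linarith [h]
      rw [e, mul_pow]
      push_cast
      calc 1 / (4 * ((k : ℝ) + 1))
          ≤ (((k : ℝ) + 1 / 2) / ((k : ℝ) + 1)) ^ 2 * (1 / (4 * (k : ℝ))) := by
            rw [div_pow, div_mul_div_comm, mul_one, div_le_div_iff₀ (by positivity) (by positivity)]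
            nlinarith
        _ ≤ (((k : ℝ) + 1 / 2) / ((k : ℝ) + 1)) ^ 2 * binomHalf k ^ 2 :=
            mul_le_mul_of_nonneg_left (ih hk') (by positivity)

/-- `1/a_n ≤ 2√n` for `n ≥ 1`. -/
theorem inv_binomHalf_le {n : ℕ} (hn : 1 ≤ n) : (binomHalf n)⁻¹ ≤ 2 * Real.sqrt n := by
  have h := le_binomHalf_sq hn
  have hp := binomHalf_pos n
  have hn' : (0 : ℝ) < n := by exact_mod_cast hn
  have hs : 0 < Real.sqrt (n : ℝ) := Real.sqrt_pos.mpr hn'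
  rw [inv_le_iff_one_le_mul₀ hp]
  -- `1 ≤ 2√n a_n ⇔ 1 ≤ 4n a_n²`
  have h4 : 1 ≤ (2 * Real.sqrt n * binomHalf n) ^ 2 := by
    rw [mul_pow, mul_pow, Real.sq_sqrt hn'.le]
    rw [div_le_iff₀ (by positivity)] at h
    linarith
  by_contra hcon
  have hX0 : 0 ≤ 2 * Real.sqrt n * binomHalf n := by positivity
  have := pow_lt_one₀ hX0 (lt_of_not_ge hcon) two_ne_zero
  linarith

/-- **`a_{n−j}/a_n ≤ 2√n`** for `j ≤ n`, `n ≥ 1`. -/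
theorem binomHalf_div_le_sqrt {n j : ℕ} (hn : 1 ≤ n) : binomHalf (n - j) / binomHalf n ≤ 2 * Real.sqrt n := by
  rw [div_eq_mul_inv]
  calc binomHalf (n - j) * (binomHalf n)⁻¹ ≤ 1 * (binomHalf n)⁻¹ :=
        mul_le_mul_of_nonneg_right (binomHalf_le_one _) (inv_nonneg.mpr (binomHalf_pos n).le)
    _ ≤ 2 * Real.sqrt n := by rw [one_mul]; exact inv_binomHalf_le hn

/-- **`a_{n−j}/a_n ≤ 2`** for `j ≤ n/2`, `n ≥ 1`. -/
theorem binomHalf_div_le_two {n j : ℕ} (hn : 1 ≤ n) (hj : j ≤ n / 2) : binomHalf (n - j) / binomHalf n ≤ 2 := by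
  have hp := binomHalf_pos n
  have hq := binomHalf_pos (n - j)
  have h1 := binomHalf_sq_le (n - j)
  have h2 := le_binomHalf_sq hn
  have hnj : (n : ℝ) + 1 ≤ 2 * ((n - j : ℕ) : ℝ) + 1 := by
    have : n ≤ 2 * (n - j) := by omega
    have : (n : ℝ) ≤ 2 * ((n - j : ℕ) : ℝ) := by exact_mod_cast this
    linarith
  have hsq : (binomHalf (n - j) / binomHalf n) ^ 2 ≤ 4 := by
    rw [div_pow, div_le_iff₀ (by positivity)]
    calc binomHalf (n - j) ^ 2 ≤ 1 / (2 * ((n - j : ℕ) : ℝ) + 1) := h1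
      _ ≤ 1 / ((n : ℝ) + 1) := one_div_le_one_div_of_le (by positivity) hnj
      _ ≤ 4 * (1 / (4 * (n : ℝ))) := by
          rw [mul_one_div, div_le_div_iff₀ (by positivity) (by positivity)]
          have : (1 : ℝ) ≤ n := by exact_mod_cast hn
          nlinarith
      _ ≤ 4 * binomHalf n ^ 2 := mul_le_mul_of_nonneg_left h2 (by norm_num)
  have hpos : 0 ≤ binomHalf (n - j) / binomHalf n := by positivity
  nlinarith [sq_nonneg (binomHalf (n - j) / binomHalf n - 2)]

/-- **`a_{n−j}/a_n ≤ (1 + 1/(2(n−m)+1))^m`** for `j ≤ m ≤ n`. -/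
theorem binomHalf_div_le_pow {n m j : ℕ} (hj : j ≤ m) (hm : m ≤ n) :
    binomHalf (n - j) / binomHalf n ≤ (1 + 1 / (2 * ((n - m : ℕ) : ℝ) + 1)) ^ m := by
  have h := binomHalf_div_le (n - j) j
  rw [Nat.sub_add_cancel (hj.trans hm)] at h
  refine h.trans ?_
  have hbase : 1 + 1 / (2 * ((n - j : ℕ) : ℝ) + 1) ≤ 1 + 1 / (2 * ((n - m : ℕ) : ℝ) + 1) := by
    have : ((n - m : ℕ) : ℝ) ≤ ((n - j : ℕ) : ℝ) := by exact_mod_cast Nat.sub_le_sub_left hj n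
    have ha : (0 : ℝ) < 2 * ((n - m : ℕ) : ℝ) + 1 := by positivity
    have hab : 2 * ((n - m : ℕ) : ℝ) + 1 ≤ 2 * ((n - j : ℕ) : ℝ) + 1 := by linarith
    linarith [one_div_le_one_div_of_le ha hab]
  calc (1 + 1 / (2 * ((n - j : ℕ) : ℝ) + 1)) ^ j ≤ (1 + 1 / (2 * ((n - m : ℕ) : ℝ) + 1)) ^ j :=
        pow_le_pow_left₀ (by positivity) hbase j
    _ ≤ (1 + 1 / (2 * ((n - m : ℕ) : ℝ) + 1)) ^ m :=
        pow_le_pow_right₀ (by linarith [show (0 : ℝ) ≤ 1 / (2 * ((n - m : ℕ) : ℝ) + 1) by positivity]) hj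

/-! ### Two limits -/

/-- `(1 + 1/(2(n−m)+1))^m → 1` as `n → ∞` (`m` fixed). -/
theorem tendsto_one_add_pow (m : ℕ) :
    Tendsto (fun n : ℕ => (1 + 1 / (2 * ((n - m : ℕ) : ℝ) + 1)) ^ m) atTop (𝓝 1) := by
  have h1 : Tendsto (fun n : ℕ => (2 * ((n - m : ℕ) : ℝ) + 1)) atTop atTop := by
    have : Tendsto (fun n : ℕ => ((n - m : ℕ) : ℝ)) atTop atTop :=
      tendsto_natCast_atTop_atTop.comp (tendsto_sub_atTop_nat m)
    exact tendsto_atTop_add_const_right _ _ (this.const_mul_atTop' (two_pos : (0 : ℝ) < 2))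
  have h2 : Tendsto (fun n : ℕ => 1 / (2 * ((n - m : ℕ) : ℝ) + 1)) atTop (𝓝 0) := by
    simp only [one_div]
    exact tendsto_inv_atTop_zero.comp h1
  have h3 := (tendsto_const_nhds (x := (1 : ℝ))).add h2
  rw [add_zero] at h3
  simpa using h3.pow m

/-- `n · z^{⌊n/2⌋} → 0` for `0 < z < 1`. -/
theorem tendsto_mul_pow_div_two {z : ℝ} (hz0 : 0 < z) (hz1 : z < 1) :
    Tendsto (fun n : ℕ => (n : ℝ) * z ^ (n / 2)) atTop (𝓝 0) := by
  set s := Real.sqrt z with hs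
  have hs0 : 0 < s := Real.sqrt_pos.mpr hz0
  have hs1 : s < 1 := by
    have := Real.sqrt_lt_sqrt hz0.le hz1
    rwa [Real.sqrt_one] at this
  have hss : s * s = z := Real.mul_self_sqrt hz0.le
  -- `z^{⌊n/2⌋} ≤ s^{n−1}` since `2⌊n/2⌋ ≥ n − 1`
  have hb : ∀ n : ℕ, z ^ (n / 2) ≤ s ^ (n - 1) := fun n => by
    rw [← hss, ← pow_two, ← pow_mul]
    exact pow_le_pow_of_le_one hs0.le hs1.le (by omega)
  have hlim : Tendsto (fun n : ℕ => (n : ℝ) * s ^ (n - 1)) atTop (𝓝 0) := by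
    have h := (tendsto_self_mul_const_pow_of_lt_one hs0.le hs1).div_const s
    rw [zero_div] at h
    refine h.congr' (eventually_atTop.mpr ⟨1, fun n hn => ?_⟩)
    obtain ⟨k, rfl⟩ : ∃ k, n = k + 1 := ⟨n - 1, by omega⟩
    simp only [Nat.add_sub_cancel]
    field_simp
    ring
  refine tendsto_of_tendsto_of_tendsto_of_le_of_le tendsto_const_nhds hlim (fun n => ?_) (fun n => ?_)
  · positivity
  · exact mul_le_mul_of_nonneg_left (hb n) (Nat.cast_nonneg n)


end Summit.Ventures.HodgeRepro2.T5SU11LegendreHeineBounds
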